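import Literature.NumberTheory.EllipticCurves.ZpExtensionEisensteinDVRSettingTame
import Literature.NumberTheory.EllipticCurves.ZpExtensionEisensteinDVRSettingSelmerCompatProofs
import Literature.NumberTheory.EllipticCurves.ZpExtensionEisensteinDVRSettingHypothesesProofs
import Literature.NumberTheory.EllipticCurves.HeegnerPointsImaginaryQuadraticProofs
import HarnessLib

/-!
# `SatisfiesH` for the curve's (tame) Eisenstein `DVRSetting`, ASSEMBLED from its fields: what is in the kernel and
# what remains an explicit hypothesis (proofs file)

Topic `NumberTheory/EllipticCurves` (D1 road of cell `pub/bsd-print-x9`; consumer-facing glue for the shared μ-crux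
stmt-BirchSwinnertonDyer-22642, STUB A `stub_howardInputs` of the v3 skeleton: «… (hy : St.SatisfiesH) …»).  THEOREMS ONLY;
no definition, no named fact, no instance, no notation, no `sorry`.

`Howard2004.DVRSetting.SatisfiesH` (32 fields: Howard's H.0–H.5 level-wise + the typing clauses T1–T7 of part B) for
`St := W.eisensteinDVRSettingTame κ hm π S hpS hbad L hL hLS jbar cd D` (the Eisenstein specialisation of `E_K` at
`𝔮 = (T^m + p)` with the tame finite–singular slots).  **`eisensteinDVRSettingTame_satisfiesH_of`** builds it from:
* the KERNEL THEOREMS of the D1 files (`coeffRing`, `unif`, `e_*`, `killed`, `ker_red`, `algebraMap_*`, `redR_comp`,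
  `scalarLinear`, `h0`, `Sigma_eq`, `cond_smul`, `cond_red` (K totally complex, from `IsImaginaryQuadratic`), `L_*`,
  `primes_eq`, `h1` (from `(irr_K)` + Schur), `πbar_red`, `θ_eq`, `h5a` (`cd.τ` a transported complex conjugation, `p ≠ 2`),
  `fsQ_spec`, `fs_natural`, `fs_admissible`);
* EXPLICIT HYPOTHESES, named after the fields they fill — exactly the obligations still open in the cell:
  `hp2 : p ≠ 2`, `hK : IsImaginaryQuadratic K`, `h2` (`H2Tower`), `h3` (H.3 at every level), `h4` (self-orthogonality of
  `F_𝔮` for the pairing data `D`), `he_red` (the pairings reduce along the tower), `h5b`, `h5c`.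
So «`St.SatisfiesH`» is, in the kernel, EQUIVALENT to the conjunction of those eight named statements (the converse
projections are the structure's own fields).  BSD is not proved by any of this.

References: [Howard2004HeegnerKolyvagin] §1.3 H.0–H.5, §1.6 (arXiv:1202.6340 p. 7 L55 – p. 8 L1, p. 11 L13–38), Def. 1.2.3;
[Gross1984] §1 (imaginary quadratic ⇒ totally complex).
-/

set_option autoImplicit false

noncomputable section

open Function NumberField IsDedekindDomain Field
open scoped NumberField ContRepresentation TensorProduct Classical

namespace WeierstrassCurve

open Literature.NumberTheory.EllipticCurves Literature.NumberTheory.GaloisRepresentations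
open Literature.NumberTheory.GaloisRepresentations.DiscreteGaloisModule
open Literature.NumberTheory.GaloisCohomology.Howard2004
open Literature.NumberTheory.EllipticCurves.ZpExtension (EisensteinLevel)

variable {K : Type} [Field K] [NumberField K] (W : WeierstrassCurve ℚ) [W.IsElliptic] {p : ℕ} [hp : Fact p.Prime]
  (κ : ZpExtension K p) {m : ℕ} (hm : 1 ≤ m) (π : ∀ v : HeightOneSpectrum (𝓞 K), TamePin v)
  (S : Finset (HeightOneSpectrum (𝓞 K)))
  (hpS : ∀ v : HeightOneSpectrum (𝓞 K), ((p : ℕ) : 𝓞 K) ∈ v.asIdeal → v ∈ S)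
  (hbad : ∀ v : HeightOneSpectrum (𝓞 K), v ∉ S → ((p : ℕ) : 𝓞 K) ∉ v.asIdeal → (W.baseChange K).HasGoodReductionAt v)
  (L : Set (HeightOneSpectrum (𝓞 K)))
  (hL : letI := IwasawaAlgebra.isLocalRing_quotient_X_pow_add_C p hm
    L ⊆ (W.eisensteinTower κ hm).degreeTwoPrimes p)
  (hLS : ∀ v ∈ L, v ∉ S)
  (jbar : AlgebraicClosure K →+* ℂ) (cd : ConjugationDatum K)
  (D : letI := IwasawaAlgebra.isLocalRing_quotient_X_pow_add_C p hm
    ∀ k, DualityDatum p cd ((W.eisensteinTower κ hm).ρ k) (IwasawaAlgebra.EisensteinCoeff p m (k + 1)))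

set_option synthInstance.maxHeartbeats 80000 in
/-- **`SatisfiesH` for the tame Eisenstein setting of `E_K`, assembled**: Howard's H.0–H.5 and the typing clauses for
`St = (T_𝔮, F_𝔮, 𝓛)` follow from the D1 kernel theorems together with the EIGHT named hypotheses `hp2`, `hK`, `h2`, `h3`,
`h4`, `he_red`, `h5b`, `h5c` (the cell's remaining obligations, verbatim the corresponding fields).  With
`eisensteinDVRSetting_largePrimes` and a Kolyvagin system this is the `(hy : St.SatisfiesH)` slot of the shared μ-crux's
`stub_howardInputs`. [cite: Howard2004HeegnerKolyvagin, §1.3 H.0–H.5 and §1.6 (arXiv p. 7 L55 – p. 8 L1, p. 11 L13–38)] -/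
theorem eisensteinDVRSettingTame_satisfiesH_of (hp2 : p ≠ 2) (hK : IsImaginaryQuadratic K)
    (hirr : (W.baseChange K).HasIrreducibleModPGaloisRep p)
    (hschur : ∀ φ : geomTorsion (W.baseChange K) (p : ℤ) →+ geomTorsion (W.baseChange K) (p : ℤ),
      (∀ (g : absoluteGaloisGroup K) (P : geomTorsion (W.baseChange K) (p : ℤ)), φ (g • P) = g • φ P) →
        ∃ c : ℤ, ∀ P : geomTorsion (W.baseChange K) (p : ℤ), φ P = c • P)
    {c₀ : absoluteGaloisGroup ℚ} (hc₀ : IsComplexConjugation (Rat.castHom ℝ) c₀)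
    (hτ : ∀ x, cd.τ x = absGaloisTransport (K := ℚ) (L := K) c₀ x)
    (h2 : letI := IwasawaAlgebra.isLocalRing_quotient_X_pow_add_C p hm
      (W.eisensteinTower κ hm).H2Tower p cd ((W.baseChange K).torsionGaloisModule (p : ℤ)))
    (h3 : letI := IwasawaAlgebra.isLocalRing_quotient_X_pow_add_C p hm
      ∀ k, H3 ((W.eisensteinTower κ hm).ρ k) (IwasawaAlgebra.EisensteinCoeff p m (k + 1))
        (W.eisensteinTowerTriple κ hm S hpS hbad L hL hLS k))
    (h4 : letI := IwasawaAlgebra.isLocalRing_quotient_X_pow_add_C p hm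
      ∀ k, (D k).IsSelfOrthogonal (W.eisensteinTowerTriple κ hm S hpS hbad L hL hLS k).cond)
    (he_red : letI := IwasawaAlgebra.isLocalRing_quotient_X_pow_add_C p hm
      ∀ k (x y : EisensteinLevel p m (fun j ↦ geomTorsion (W.baseChange K) ((p : ℤ) ^ j)) (k + 1 + 1)),
        IwasawaAlgebra.EisensteinCoeff.reduce p m (Nat.le_succ (k + 1)) ((D (k + 1)).e x y) =
          (D k).e ((W.eisensteinTower κ hm).red k x) ((W.eisensteinTower κ hm).red k y))
    (h5b :
    letI := IwasawaAlgebra.isDomain_quotient_X_pow_add_C p hm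
    letI := IwasawaAlgebra.isDiscreteValuationRing_quotient_X_pow_add_C p hm
    haveI := IwasawaAlgebra.EisensteinCoeff.isLocalRing_succ p hm
    letI := IwasawaAlgebra.EisensteinCoeff.algebraOfSpecSucc p m
    haveI := W.isScalarTower_algebraOfSpecSucc (K := K) (p := p) (m := m)
    letI := W.residueModuleSucc (K := K) (p := p) hm
      ∀ k, H5b (R := IwasawaAlgebra.EisensteinCoeff p m (k + 1)) ((W.eisensteinTower κ hm).ρ k)
        (W.isQuotientBy_eisensteinDVRSetting_πbar κ hm S hpS hbad L hL hLS jbar cd D (W.eisensteinTameFs κ hm π) k)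
        (W.residualTauGeomTorsion (p := p) cd hm (k := k + 1) k.succ_pos)
        (W.eisensteinTowerTriple κ hm S hpS hbad L hL hLS k).cond)
    (h5c :
    letI := IwasawaAlgebra.isDomain_quotient_X_pow_add_C p hm
    letI := IwasawaAlgebra.isDiscreteValuationRing_quotient_X_pow_add_C p hm
    haveI := IwasawaAlgebra.EisensteinCoeff.isLocalRing_succ p hm
    letI := IwasawaAlgebra.EisensteinCoeff.algebraOfSpecSucc p m
    haveI := W.isScalarTower_algebraOfSpecSucc (K := K) (p := p) (m := m)
    letI := W.residueModuleSucc (K := K) (p := p) hm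
      ∀ k, H5c (D k) ((W.eisensteinDVRSettingTame κ hm π S hpS hbad L hL hLS jbar cd D).πbar k) (W.residualTauGeomTorsion (p := p) cd hm (k := k + 1) k.succ_pos)) :
    letI := IwasawaAlgebra.isDomain_quotient_X_pow_add_C p hm
    letI := IwasawaAlgebra.isDiscreteValuationRing_quotient_X_pow_add_C p hm
    haveI := IwasawaAlgebra.EisensteinCoeff.isLocalRing_succ p hm
    letI := IwasawaAlgebra.EisensteinCoeff.algebraOfSpecSucc p m
    haveI := W.isScalarTower_algebraOfSpecSucc (K := K) (p := p) (m := m)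
    letI := W.residueModuleSucc (K := K) (p := p) hm
    (W.eisensteinDVRSettingTame κ hm π S hpS hbad L hL hLS jbar cd D).SatisfiesH := by
  letI := IwasawaAlgebra.isDomain_quotient_X_pow_add_C p hm
  letI := IwasawaAlgebra.isDiscreteValuationRing_quotient_X_pow_add_C p hm
  haveI := IwasawaAlgebra.EisensteinCoeff.isLocalRing_succ p hm
  letI := IwasawaAlgebra.EisensteinCoeff.algebraOfSpecSucc p m
  haveI := W.isScalarTower_algebraOfSpecSucc (K := K) (p := p) (m := m)
  letI := W.residueModuleSucc (K := K) (p := p) hm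
  haveI : IsTotallyComplex K := hK.isTotallyComplex
  exact
    { coeffRing := eisensteinDVRSetting_coeffRing (p := p) hm
      p_odd := hp2
      imagQuad := hK
      unif := W.eisensteinDVRSetting_unif κ hm S hpS hbad L hL hLS jbar cd D (W.eisensteinTameFs κ hm π)
      e_strictMono := W.eisensteinDVRSetting_e_strictMono κ hm S hpS hbad L hL hLS jbar cd D (W.eisensteinTameFs κ hm π)
      e_zero := W.eisensteinDVRSetting_e_zero κ hm S hpS hbad L hL hLS jbar cd D (W.eisensteinTameFs κ hm π)
      killed := W.eisensteinDVRSetting_killed κ hm S hpS hbad L hL hLS jbar cd D (W.eisensteinTameFs κ hm π)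
      ker_red := W.eisensteinDVRSetting_ker_red κ hm S hpS hbad L hL hLS jbar cd D (W.eisensteinTameFs κ hm π)
      algebraMap_surjective := fun k ↦ eisensteinDVRSetting_algebraMap_surjective (p := p) (m := m) k
      ker_algebraMap := W.eisensteinDVRSetting_ker_algebraMap κ hm S hpS hbad L hL hLS jbar cd D (W.eisensteinTameFs κ hm π)
      redR_comp := W.eisensteinDVRSetting_redR_comp κ hm S hpS hbad L hL hLS jbar cd D (W.eisensteinTameFs κ hm π)
      scalarLinear := W.eisensteinDVRSetting_scalarLinear κ hm S hpS hbad L hL hLS jbar cd D (W.eisensteinTameFs κ hm π)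
      h0 := fun k ↦ W.eisensteinDVRSetting_h0 (K := K) (p := p) hm k
      Sigma_eq := W.eisensteinDVRSetting_t_Sigma κ hm S hpS hbad L hL hLS jbar cd D (W.eisensteinTameFs κ hm π)
      cond_smul := W.eisensteinDVRSetting_cond_smul κ hm S hpS hbad L hL hLS jbar cd D (W.eisensteinTameFs κ hm π)
      cond_red := W.eisensteinDVRSetting_cond_red κ hm S hpS hbad L hL hLS jbar cd D (W.eisensteinTameFs κ hm π)
      L_subset := W.eisensteinDVRSetting_L_subset κ hm S hpS hbad L hL hLS jbar cd D (W.eisensteinTameFs κ hm π)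
      L_disjoint := W.eisensteinDVRSetting_L_disjoint κ hm S hpS hbad L hL hLS jbar cd D (W.eisensteinTameFs κ hm π)
      primes_eq := W.eisensteinDVRSetting_t_primes κ hm S hpS hbad L hL hLS jbar cd D (W.eisensteinTameFs κ hm π)
      h1 := W.eisensteinDVRSetting_h1_of_schur κ hm S hpS hbad L hL hLS jbar cd D (W.eisensteinTameFs κ hm π) hirr hschur
      πbar_red := fun k y ↦ W.eisensteinDVRSetting_πbar_red κ hm S hpS hbad L hL hLS jbar cd D (W.eisensteinTameFs κ hm π) k y
      h2 := h2
      h3 := h3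
      h4 := h4
      e_red := he_red
      θ_eq := W.eisensteinDVRSetting_θ_eq κ hm S hpS hbad L hL hLS jbar cd D (W.eisensteinTameFs κ hm π)
      h5a := W.eisensteinDVRSetting_h5a κ hm S hpS hbad L hL hLS jbar cd D (W.eisensteinTameFs κ hm π) hc₀ hτ hp2
      h5b := h5b
      h5c := h5c
      fsQ_spec := W.eisensteinDVRSetting_fsQ_spec κ hm S hpS hbad L hL hLS jbar cd D (W.eisensteinTameFs κ hm π)
      fs_natural := W.eisensteinDVRSettingTame_fs_natural κ hm π S hpS hbad L hL hLS jbar cd D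
      fs_admissible := W.eisensteinDVRSettingTame_fs_admissible κ hm π S hpS hbad L hL hLS jbar cd D }

end WeierstrassCurve

end
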